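import Summits.BirchSwinnertonDyer.BirchSwinnertonDyer.Theorems.SoloBlindRankFourWitness
import Literature.NumberTheory.EllipticCurves.MordellWeilTheoremProofs

/-!
# SoloBlind — a rank-four elliptic curve over `ℚ` and the existential floor of rank-BSD, unconditionally

`SoloBlindRankFourWitness` certified in the kernel that the four explicit points `P₀, …, P₃` of
`E4 : y² + xy = x³ − x² − 79x + 289` (Cremona label `234446a1`; in Lean the bound variable `W` under
`hW : W = ⟨1, -1, 0, -79, 289⟩`) are `ℤ`-linearly independent in `E4(ℚ)`, and derived
`4 ≤ mordellWeilRank E4` and `BirchSwinnertonDyer → ∃ W, W.IsElliptic ∧ 4 ≤ W.analyticRank`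
GRANTING the Mordell–Weil theorem for `E4` (the named fact `WeierstrassCurve.module_finite_point`,
carried there as a hypothesis `hMW`: `Module.finrank` is `0` on a module that is not finitely
generated, so linear independence alone does not bound `finrank` below).

The Literature library PROVES the Mordell–Weil theorem for every elliptic curve over a number field
(`WeierstrassCurve.module_finite_point_holds`, `MordellWeilTheoremProofs`: weak Mordell–Weil for
`m = 2` by Kummer theory and Hermite–Minkowski, then descent with the naive height; Silverman AEC
Thm. VIII.6.7).  This file discharges `hMW` with it.  Results, all hypothesis-free and on the
standard axioms:

* `four_le_rank_E4` — `4 ≤ rank_ℤ E4(ℚ)` (so there is an elliptic curve over `ℚ` of Mordell–Weil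
  rank ≥ 4: `⟨_, E4_isElliptic rfl, four_le_rank_E4 rfl⟩`; the bare existential is already a
  declaration of the tree and is not restated here);
* `bsd_exists_four_le_analyticRank` — rank-BSD implies that the `L`-function of some elliptic curve
  over `ℚ` vanishes to order at least four at `s = 1` (the existential floor `(∃4)`; no instance of
  `ord_{s=1} L(E,s) ≥ 4` is presently a theorem for any `E/ℚ`), and its contrapositive
  `not_bsd_of_analyticRank_le_three` — a proof that analytic ranks over `ℚ` are at most three would
  refute the conjecture;
* `layer_four_exists_four_le_analyticRank` — the same floor from the single layer
  `rank ≥ 4 ⟹ ord ≥ 4`.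

No definitions are introduced.
-/

set_option linter.dupNamespace false

namespace Summit.BirchSwinnertonDyer.BirchSwinnertonDyer.Theorems.SoloBlind

open WeierstrassCurve WeierstrassCurve.Affine

variable {W : WeierstrassCurve ℚ}

/-- **The curve `234446a1` has Mordell–Weil rank at least four**, unconditionally: the Mordell–Weil
hypothesis of `four_le_mordellWeilRank_E4` is discharged by the Literature proof of the
Mordell–Weil theorem `WeierstrassCurve.module_finite_point_holds` (Silverman AEC Thm. VIII.6.7). -/
theorem four_le_rank_E4 (hW : W = ⟨1, -1, 0, -79, 289⟩) : 4 ≤ W.mordellWeilRank :=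
  four_le_mordellWeilRank_E4 hW W.module_finite_point_holds

/-- **Rank-BSD forces `ord_{s=1} L(E4, s) ≥ 4`** for `E4 = 234446a1`. -/
theorem bsd_four_le_analyticRank_E4 (hW : W = ⟨1, -1, 0, -79, 289⟩)
    (hBSD : _root_.BirchSwinnertonDyer) : 4 ≤ W.analyticRank :=
  four_le_analyticRank_E4_of_bsd hW W.module_finite_point_holds hBSD

/-- **The existential floor `(∃4)` is a consequence of the summit, unconditionally in the kernel.**
Rank-BSD implies that some elliptic curve over `ℚ` has an `L`-function vanishing to order at least
four at `s = 1`. -/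
theorem bsd_exists_four_le_analyticRank (hBSD : _root_.BirchSwinnertonDyer) :
    ∃ W : WeierstrassCurve ℚ, W.IsElliptic ∧ 4 ≤ W.analyticRank :=
  exists_four_le_analyticRank_of_bsd (module_finite_point_holds _) hBSD

/-- Contrapositive: **if every elliptic curve over `ℚ` had analytic rank at most three, rank-BSD
would be false.**  (The falsifiability handle of the conjecture on the analytic side that the
rank-four certificate provides.) -/
theorem not_bsd_of_analyticRank_le_three
    (h3 : ∀ W : WeierstrassCurve ℚ, W.IsElliptic → W.analyticRank ≤ 3) :
    ¬ _root_.BirchSwinnertonDyer := fun hBSD => by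
  obtain ⟨W, hE, h4⟩ := bsd_exists_four_le_analyticRank hBSD
  exact absurd (h3 W hE) (by omega)

/-- The floor `(∃4)` from the single layer `rank ≥ 4 ⟹ ord ≥ 4` of the conjecture (the
Mordell–Weil shadow of "`L‴(E,1)` is accounted for by at most three independent points"),
unconditionally. -/
theorem layer_four_exists_four_le_analyticRank
    (hU4 : ∀ W : WeierstrassCurve ℚ, W.IsElliptic → 4 ≤ W.mordellWeilRank → 4 ≤ W.analyticRank) :
    ∃ W : WeierstrassCurve ℚ, W.IsElliptic ∧ 4 ≤ W.analyticRank :=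
  exists_four_le_analyticRank_of_layer_four (module_finite_point_holds _) hU4

end Summit.BirchSwinnertonDyer.BirchSwinnertonDyer.Theorems.SoloBlind
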